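import Summits.QuantumFields.YangMills.Theorems.FluctuationComparisonRegPrIntLOrganTangentLawSquareIntegrationLip
import HarnessLib

/-!
# Crux `FluctuationComparisonRegPrIntL` (stmt-QuantumFields-20520, rung R3), PATH-B organ, H-currency cone — (L28a) THE (I-law) DOCK, PART 1: the (L1ʲ-h) and (L2ʲ-h) CONJUNCTS
# of `SpreadFibreLawH` (✓p812742) at one `t` FROM an INSTANCE-FREE, print-shaped (I-law) block (LEAD w3 g26 DESIGN CALL №34 ∕ №29 (c) ∕ №30; ideator g29 №2 «the `U`-binder point»)

Cell `ym3-torus` (YM ladder rung R3 = continuum `SU(2)` Yang–Mills on the three-torus — a RUNG: NOT d = 4, NOT infinite volume, NOT a mass gap, NOT Clay).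
Width seat `ym-ust-20520-w5` (gen 24), `--supports stmt-QuantumFields-20520 --as helper`, count-neutral, no registry ∕ binder ∕ `Lines/` edit, DEFINITION-FREE,
default heartbeats.  Over ✓(L27b∕c) `_of_lip` bricks.

WHY.  The row `OrganDischargeInputsHJ` (LEAD∕g29 pen) must carry the law-side inputs as TEXT.  Two typing hazards are removed here: (i) `Function.update` needs a
`DecidableEq (PBond …)` instance (TN-INSTANCE-SHADOW) — so the blocks below quantify the law path RELATIONALLY (`∀ X, (∀ s e, e ≠ B′ → X s e = U₂ e) → (∀ s, X s B′ = U₂ B′·expPt (s•m′)) → …`,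
exactly the rows' corner style), instance-free; (ii) the open neighbourhood is PINNED to `Set.Ioo (-1) 2` (g29 №2).  The theorems take (a) KNIT-SIDE facts (non-negativity of `wNum`,
measurability, integrability ∕ non-zero mass ALONG the path — frame + (I-geo) material) and (b) the (I-law-X) ∕ (I-law-L) block at `t` as the LAST hypothesis, and return the
(L1ʲ-h) ∕ (L2ʲ-h) conjunct of ✓p812742 at `t` VERBATIM (`∃ kX, nonneg ∧ row mass ∧ column mass ∧ ∀ squares, …` ∕ `∃ kL, …`).  So the row's (I-law) group = the hypothesis texts
`hIlawX` ∕ `hIlawL` below (copy by paren-matching), and the knit's lines are `exact l1j_of_ilaw … hIlawX` ∕ `exact l2j_of_ilaw … hIlawL`.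
* §1 `relPath_zero` ∕ `relPath_one` ∕ `relSquare_corners` (endpoints of relational exponential paths∕squares, no `update`), `exists_relPath` ∕ `exists_relSquare` (they exist — `update`
  under `classical`, for the knit).
* §2 ★★★`l1j_of_ilaw`, ★★★`l2j_of_ilaw`.

HONEST FRAMING: bookkeeping [folklore]; every (I-law) input is a HYPOTHESIS; nothing of Bałaban's analysis is asserted or proved; `SpreadFibreLawH(J)` ∕ `OrganDischargeInputsHJ` are
HYPOTHESIS rows, exactly as open; LIN″ ∕ JVAR″ ∕ JEN″ ∕ O1ᵘ-H v2.2 ∕ S1aᴴ ∕ S3ᴴ ∕ S2α′ ∕ S2β, the five registered stubs of `Lines/semiclassical_s2beta.lean`, crux 20520 and `YM3TorusSU2` are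
NOT proved; registry untouched; rung R3 = SU(2) YM₃ on T³ at fixed lattice data — NOT d = 4, NOT infinite volume, NOT a mass gap, NOT Clay; the Yang–Mills mass gap is NOT proved.  [folklore].
-/

set_option autoImplicit false

noncomputable section

namespace Summit.QuantumFields.YangMills.Theorems.OrganTangentLawClausesOfILaw

open MeasureTheory Filter Topology Set Function
open scoped ENNReal
open Literature.MathematicalPhysics.QuantumFieldTheory.Balaban1983to89 T3ContinuumYM3Torus T3NestedUnitLaws T3UnitLawDensityEML T4Continuum BalabanUVClass
  T3UnitScaleTilt T3LevelShift T3TiltDescent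
open T4CubeChartExp (expPt)
open Summit.QuantumFields.YangMills.Theorems.FluctuationComparisonRegPrIntLRunpairOrganFibreLaw (wNum wgt)
open Summit.QuantumFields.YangMills.Theorems.OrganTangentLawEdgeIntegrationLip
open Summit.QuantumFields.YangMills.Theorems.OrganTangentLawSquareIntegrationLip

/-! ## §1 Relational exponential law paths and squares (instance-free) -/

section Paths

variable {P : Params} {j : ℕ}

/-- A relational one-bond exponential path starts at its base. [folklore] -/
theorem relPath_zero {U : GaugeField P j ↥(Matrix.specialUnitaryGroup (Fin 2) ℂ)} {B' : PBond P j} {m' : Fin 3 → ℝ} {X : ℝ → GaugeField P j ↥(Matrix.specialUnitaryGroup (Fin 2) ℂ)}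
    (hoff : ∀ s e, e ≠ B' → X s e = U e) (hon : ∀ s, X s B' = U B' * expPt (s • m')) : X 0 = U := by
  funext e
  by_cases he : e = B'
  · subst he; rw [hon, zero_smul, T4CubeChartExp.expPt_zero, mul_one]
  · exact hoff 0 e he

/-- … and ends at the relational corner `W` (`(∀ e ≠ B′, W e = U e) ∧ W B′ = U B′·expPt m′`). [folklore] -/
theorem relPath_one {U W : GaugeField P j ↥(Matrix.specialUnitaryGroup (Fin 2) ℂ)} {B' : PBond P j} {m' : Fin 3 → ℝ} {X : ℝ → GaugeField P j ↥(Matrix.specialUnitaryGroup (Fin 2) ℂ)}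
    (hoff : ∀ s e, e ≠ B' → X s e = U e) (hon : ∀ s, X s B' = U B' * expPt (s • m'))
    (hWoff : ∀ e, e ≠ B' → W e = U e) (hWon : W B' = U B' * expPt m') : X 1 = W := by
  funext e
  by_cases he : e = B'
  · subst he; rw [hon, one_smul, hWon]
  · rw [hoff 1 e he, hWoff e he]

/-- Such a path exists (`Function.update` under `classical`; the knit's witness). [folklore] -/
theorem exists_relPath (U : GaugeField P j ↥(Matrix.specialUnitaryGroup (Fin 2) ℂ)) (B' : PBond P j) (m' : Fin 3 → ℝ) :
    ∃ X : ℝ → GaugeField P j ↥(Matrix.specialUnitaryGroup (Fin 2) ℂ), (∀ s e, e ≠ B' → X s e = U e) ∧ (∀ s, X s B' = U B' * expPt (s • m')) := by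
  classical
  exact ⟨fun s => update U B' (U B' * expPt (s • m')), fun s e he => update_of_ne he _ _, fun s => update_self _ _ _⟩

/-- The four corners of a relational exponential square (`Y` the `B`-path from `V00`, `X s s′` the `B′`-move of `Y s`). [folklore] -/
theorem relSquare_corners {V00 V10 V01 V11 : GaugeField P j ↥(Matrix.specialUnitaryGroup (Fin 2) ℂ)} {B B' : PBond P j} {m m' : Fin 3 → ℝ}
    {Y : ℝ → GaugeField P j ↥(Matrix.specialUnitaryGroup (Fin 2) ℂ)} {X : ℝ → ℝ → GaugeField P j ↥(Matrix.specialUnitaryGroup (Fin 2) ℂ)}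
    (hYoff : ∀ s e, e ≠ B → Y s e = V00 e) (hYon : ∀ s, Y s B = V00 B * expPt (s • m))
    (hXoff : ∀ s s' e, e ≠ B' → X s s' e = Y s e) (hXon : ∀ s s', X s s' B' = Y s B' * expPt (s' • m'))
    (h10 : ∀ e, e ≠ B → V10 e = V00 e) (h10B : V10 B = V00 B * expPt m) (h01 : ∀ e, e ≠ B' → V01 e = V00 e) (h01B : V01 B' = V00 B' * expPt m')
    (h11 : ∀ e, e ≠ B' → V11 e = V10 e) (h11B : V11 B' = V10 B' * expPt m') :
    X 0 0 = V00 ∧ X 1 0 = V10 ∧ X 0 1 = V01 ∧ X 1 1 = V11 := by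
  have hY0 : Y 0 = V00 := relPath_zero hYoff hYon
  have hY1 : Y 1 = V10 := relPath_one hYoff hYon h10 h10B
  have hX0 : ∀ s, X s 0 = Y s := fun s =>
    relPath_zero (U := Y s) (X := fun s' => X s s') (fun s' e he => hXoff s s' e he) (fun s' => hXon s s')
  refine ⟨by rw [hX0, hY0], by rw [hX0, hY1], ?_, ?_⟩
  · exact relPath_one (U := Y 0) (X := fun s' => X 0 s') (fun s' e he => hXoff 0 s' e he) (fun s' => hXon 0 s')
      (fun e he => by rw [hY0]; exact h01 e he) (by rw [hY0]; exact h01B)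
  · exact relPath_one (U := Y 1) (X := fun s' => X 1 s') (fun s' e he => hXoff 1 s' e he) (fun s' => hXon 1 s')
      (fun e he => by rw [hY1]; exact h11 e he) (by rw [hY1]; exact h11B)

/-- Such a square exists (the knit's witness). [folklore] -/
theorem exists_relSquare (V00 : GaugeField P j ↥(Matrix.specialUnitaryGroup (Fin 2) ℂ)) (B B' : PBond P j) (m m' : Fin 3 → ℝ) :
    ∃ (Y : ℝ → GaugeField P j ↥(Matrix.specialUnitaryGroup (Fin 2) ℂ)) (X : ℝ → ℝ → GaugeField P j ↥(Matrix.specialUnitaryGroup (Fin 2) ℂ)),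
      (∀ s e, e ≠ B → Y s e = V00 e) ∧ (∀ s, Y s B = V00 B * expPt (s • m)) ∧
      (∀ s s' e, e ≠ B' → X s s' e = Y s e) ∧ (∀ s s', X s s' B' = Y s B' * expPt (s' • m')) := by
  classical
  refine ⟨fun s => update V00 B (V00 B * expPt (s • m)),
    fun s s' => update (update V00 B (V00 B * expPt (s • m))) B' ((update V00 B (V00 B * expPt (s • m))) B' * expPt (s' • m')),
    fun s e he => update_of_ne he _ _, fun s => update_self _ _ _, fun s s' e he => update_of_ne he _ _, fun s s' => update_self _ _ _⟩

end Paths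

/-! ## §2 The (L1ʲ-h) and (L2ʲ-h) conjuncts from the (I-law) blocks -/

section Clauses

/-- ★★★ **(L1ʲ-h) AT `t` FROM THE (I-law-X) BLOCK** (see the module docstring): the last hypothesis `hIlawX` IS the row text (letter `kX` with ✓p812742's row∕column masses, then per
square and per RELATIONAL law path `X`: a derivative family `wN′`, Lipschitz constants `b bΔ`, (Lip) on `Set.Ioo (-1) 2`, (Diff₀) on `[0,1]`, and the SCORE covariance kernel
`≤ kX B B′·sz·sz′`); the knit-side facts are `hw0` (✓`wNum_nonneg`), `hmF`∕`hmW` (measurability), `hpath` (integrability of `wNum`, `F_{U₁}·wNum`, `F_{V₁}·wNum` and non-zero mass ALONG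
the path, `s ∈ [0,1]` — frame + (I-geo)); conclusion = the (L1ʲ-h) conjunct of ✓p812742 at `t` VERBATIM. [folklore] -/
theorem l1j_of_ilaw (F : T3Family) (γ b₀ p₀ : ℝ) (j Ts : ℕ)
    (ρ ρ' : (i : ℕ) → GaugeField (F.P i) 0 ↥(Matrix.specialUnitaryGroup (Fin 2) ℂ) → ℝ) {Zc : Type} [MeasurableSpace Zc] (τ : Measure Zc)
    (Φ : GaugeField (F.P j) 0 ↥(Matrix.specialUnitaryGroup (Fin 2) ℂ) × Zc → GaugeField (F.P Ts) 0 ↥(Matrix.specialUnitaryGroup (Fin 2) ℂ)) (J : GaugeField (F.P j) 0 ↥(Matrix.specialUnitaryGroup (Fin 2) ℂ) × Zc → NNReal)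
    (κ rc w NX : ℝ) (δX : ℕ → ℝ) (t : ℝ)
    (hw0 : ∀ (V : GaugeField (F.P j) 0 ↥(Matrix.specialUnitaryGroup (Fin 2) ℂ)) z, 0 ≤ wNum F γ b₀ p₀ j Ts ρ ρ' Φ J t V z)
    (hmF : ∀ (V : GaugeField (F.P j) 0 ↥(Matrix.specialUnitaryGroup (Fin 2) ℂ)), AEStronglyMeasurable (fun z => Real.log (ρ Ts (Φ (V, z))) - Real.log (ρ' Ts (Φ (V, z)))) τ)
    (hmW : ∀ (V : GaugeField (F.P j) 0 ↥(Matrix.specialUnitaryGroup (Fin 2) ℂ)), AEStronglyMeasurable (fun z => wNum F γ b₀ p₀ j Ts ρ ρ' Φ J t V z) τ)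
    (hpath : ∀ (B' : PBond (F.P j) 0) (m' : Fin 3 → ℝ) (U₁ V₁ U₂ : GaugeField (F.P j) 0 ↥(Matrix.specialUnitaryGroup (Fin 2) ℂ)) (X : ℝ → GaugeField (F.P j) 0 ↥(Matrix.specialUnitaryGroup (Fin 2) ℂ)), ‖m'‖ ≤ rc * (θBal F.L γ b₀ p₀ j / 4) →
      PlaqSmall (θBal F.L γ b₀ p₀ j / 4) U₁ → PlaqSmall (θBal F.L γ b₀ p₀ j / 4) V₁ → PlaqSmall (θBal F.L γ b₀ p₀ j / 4) U₂ → (∀ s e, e ≠ B' → X s e = U₂ e) → (∀ s, X s B' = U₂ B' * expPt (s • m')) →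
      ∀ s ∈ Set.Icc (0:ℝ) 1, Integrable (fun z => wNum F γ b₀ p₀ j Ts ρ ρ' Φ J t (X s) z) τ ∧ Integrable (fun z => (Real.log (ρ Ts (Φ (U₁, z))) - Real.log (ρ' Ts (Φ (U₁, z)))) * wNum F γ b₀ p₀ j Ts ρ ρ' Φ J t (X s) z) τ ∧
        Integrable (fun z => (Real.log (ρ Ts (Φ (V₁, z))) - Real.log (ρ' Ts (Φ (V₁, z)))) * wNum F γ b₀ p₀ j Ts ρ ρ' Φ J t (X s) z) τ ∧ ∫ z, wNum F γ b₀ p₀ j Ts ρ ρ' Φ J t (X s) z ∂τ ≠ 0)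
    (hIlawX : ∃ kX : PBond (F.P j) 0 → PBond (F.P j) 0 → ℝ, (∀ B B', 0 ≤ kX B B') ∧ (∀ B, ∑ B', kX B B' * Real.exp (κ * (B.src.tdist B'.src : ℝ)) ≤ NX * ((((F.L : ℝ) ^ j / γ) * θBal F.L γ b₀ p₀ j ^ 2) / (((F.L : ℝ) ^ Ts / γ) * θBal F.L γ b₀ p₀ Ts ^ 2)) * w + δX j * (((F.L : ℝ) ^ j / γ) * θBal F.L γ b₀ p₀ j ^ 2)) ∧ (∀ B', ∑ B, kX B B' * Real.exp (κ * (B.src.tdist B'.src : ℝ)) ≤ NX * ((((F.L : ℝ) ^ j / γ) * θBal F.L γ b₀ p₀ j ^ 2) / (((F.L : ℝ) ^ Ts / γ) * θBal F.L γ b₀ p₀ Ts ^ 2)) * w + δX j * (((F.L : ℝ) ^ j / γ) * θBal F.L γ b₀ p₀ j ^ 2)) ∧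
      (∀ (B B' : PBond (F.P j) 0) (m m' : Fin 3 → ℝ) (U₁ V₁ U₂ W₂ : GaugeField (F.P j) 0 ↥(Matrix.specialUnitaryGroup (Fin 2) ℂ)), ‖m‖ ≤ rc * (θBal F.L γ b₀ p₀ j / 4) → ‖m'‖ ≤ rc * (θBal F.L γ b₀ p₀ j / 4) → PlaqSmall (θBal F.L γ b₀ p₀ j / 4) U₁ → PlaqSmall (θBal F.L γ b₀ p₀ j / 4) V₁ → PlaqSmall (θBal F.L γ b₀ p₀ j / 4) U₂ → PlaqSmall (θBal F.L γ b₀ p₀ j / 4) W₂ → (∀ e, e ≠ B → V₁ e = U₁ e) → V₁ B = U₁ B * expPt m → (∀ e, e ≠ B' → W₂ e = U₂ e) → W₂ B' = U₂ B' * expPt m' → ∀ (X : ℝ → GaugeField (F.P j) 0 ↥(Matrix.specialUnitaryGroup (Fin 2) ℂ)), (∀ s e, e ≠ B' → X s e = U₂ e) → (∀ s, X s B' = U₂ B' * expPt (s • m')) →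
          ∃ (wN' : ℝ → Zc → ℝ) (b bΔ : Zc → ℝ), Integrable b τ ∧ Integrable bΔ τ ∧ (∀ s, AEStronglyMeasurable (wN' s) τ) ∧
            (∀ᵐ z ∂τ, LipschitzOnWith (Real.nnabs (b z)) (fun s => wNum F γ b₀ p₀ j Ts ρ ρ' Φ J t (X s) z) (Set.Ioo (-1) 2)) ∧
            (∀ᵐ z ∂τ, LipschitzOnWith (Real.nnabs (bΔ z)) (fun s => ((Real.log (ρ Ts (Φ (V₁, z))) - Real.log (ρ' Ts (Φ (V₁, z)))) - (Real.log (ρ Ts (Φ (U₁, z))) - Real.log (ρ' Ts (Φ (U₁, z))))) * wNum F γ b₀ p₀ j Ts ρ ρ' Φ J t (X s) z) (Set.Ioo (-1) 2)) ∧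
            (∀ s ∈ Set.Icc (0:ℝ) 1, ∀ᵐ z ∂τ, HasDerivAt (fun s => wNum F γ b₀ p₀ j Ts ρ ρ' Φ J t (X s) z) (wN' s z) s) ∧
            (∀ s ∈ Set.Icc (0:ℝ) 1, |(∫ z, ((Real.log (ρ Ts (Φ (V₁, z))) - Real.log (ρ' Ts (Φ (V₁, z)))) - (Real.log (ρ Ts (Φ (U₁, z))) - Real.log (ρ' Ts (Φ (U₁, z))))) * (wN' s z / wNum F γ b₀ p₀ j Ts ρ ρ' Φ J t (X s) z) * (wNum F γ b₀ p₀ j Ts ρ ρ' Φ J t (X s) z / ∫ z', wNum F γ b₀ p₀ j Ts ρ ρ' Φ J t (X s) z' ∂τ) ∂τ)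
                - (∫ z, ((Real.log (ρ Ts (Φ (V₁, z))) - Real.log (ρ' Ts (Φ (V₁, z)))) - (Real.log (ρ Ts (Φ (U₁, z))) - Real.log (ρ' Ts (Φ (U₁, z))))) * (wNum F γ b₀ p₀ j Ts ρ ρ' Φ J t (X s) z / ∫ z', wNum F γ b₀ p₀ j Ts ρ ρ' Φ J t (X s) z' ∂τ) ∂τ) * (∫ z, (wN' s z / wNum F γ b₀ p₀ j Ts ρ ρ' Φ J t (X s) z) * (wNum F γ b₀ p₀ j Ts ρ ρ' Φ J t (X s) z / ∫ z', wNum F γ b₀ p₀ j Ts ρ ρ' Φ J t (X s) z' ∂τ) ∂τ)| ≤ kX B B' * (‖m‖ / (θBal F.L γ b₀ p₀ j / 4)) * (‖m'‖ / (θBal F.L γ b₀ p₀ j / 4))))) :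
    ∃ kX : PBond (F.P j) 0 → PBond (F.P j) 0 → ℝ, (∀ B B', 0 ≤ kX B B') ∧ (∀ B, ∑ B', kX B B' * Real.exp (κ * (B.src.tdist B'.src : ℝ)) ≤ NX * ((((F.L : ℝ) ^ j / γ) * θBal F.L γ b₀ p₀ j ^ 2) / (((F.L : ℝ) ^ Ts / γ) * θBal F.L γ b₀ p₀ Ts ^ 2)) * w + δX j * (((F.L : ℝ) ^ j / γ) * θBal F.L γ b₀ p₀ j ^ 2)) ∧ (∀ B', ∑ B, kX B B' * Real.exp (κ * (B.src.tdist B'.src : ℝ)) ≤ NX * ((((F.L : ℝ) ^ j / γ) * θBal F.L γ b₀ p₀ j ^ 2) / (((F.L : ℝ) ^ Ts / γ) * θBal F.L γ b₀ p₀ Ts ^ 2)) * w + δX j * (((F.L : ℝ) ^ j / γ) * θBal F.L γ b₀ p₀ j ^ 2)) ∧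
      (∀ (B B' : PBond (F.P j) 0) (m m' : Fin 3 → ℝ) (U₁ V₁ U₂ W₂ : GaugeField (F.P j) 0 ↥(Matrix.specialUnitaryGroup (Fin 2) ℂ)), ‖m‖ ≤ rc * (θBal F.L γ b₀ p₀ j / 4) → ‖m'‖ ≤ rc * (θBal F.L γ b₀ p₀ j / 4) → PlaqSmall (θBal F.L γ b₀ p₀ j / 4) U₁ → PlaqSmall (θBal F.L γ b₀ p₀ j / 4) V₁ → PlaqSmall (θBal F.L γ b₀ p₀ j / 4) U₂ → PlaqSmall (θBal F.L γ b₀ p₀ j / 4) W₂ → (∀ e, e ≠ B → V₁ e = U₁ e) → V₁ B = U₁ B * expPt m → (∀ e, e ≠ B' → W₂ e = U₂ e) → W₂ B' = U₂ B' * expPt m' → Integrable (fun z => (Real.log (ρ Ts (Φ (U₁, z))) - Real.log (ρ' Ts (Φ (U₁, z)))) * (wgt F γ b₀ p₀ j Ts ρ ρ' τ Φ J t) U₂ z) τ ∧ Integrable (fun z => (Real.log (ρ Ts (Φ (V₁, z))) - Real.log (ρ' Ts (Φ (V₁, z)))) * (wgt F γ b₀ p₀ j Ts ρ ρ' τ Φ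 J t) U₂ z) τ ∧ Integrable (fun z => (Real.log (ρ Ts (Φ (U₁, z))) - Real.log (ρ' Ts (Φ (U₁, z)))) * (wgt F γ b₀ p₀ j Ts ρ ρ' τ Φ J t) W₂ z) τ ∧ Integrable (fun z => (Real.log (ρ Ts (Φ (V₁, z))) - Real.log (ρ' Ts (Φ (V₁, z)))) * (wgt F γ b₀ p₀ j Ts ρ ρ' τ Φ J t) W₂ z) τ ∧ |((∫ z, (Real.log (ρ Ts (Φ (V₁, z))) - Real.log (ρ' Ts (Φ (V₁, z)))) * (wgt F γ b₀ p₀ j Ts ρ ρ' τ Φ J t) W₂ z ∂τ) - (∫ z, (Real.log (ρ Ts (Φ (U₁, z))) - Real.log (ρ' Ts (Φ (U₁, z)))) * (wgt F γ b₀ p₀ j Ts ρ ρ' τ Φ J t) W₂ z ∂τ)) - ((∫ z, (Real.log (ρ Ts (Φ (V₁, z))) - Real.log (ρ' Ts (Φ (V₁, z)))) * (wgt F γ b₀ p₀ j Ts ρ ρ' τ Φ J t) U₂ z ∂τ) - (∫ z, (Real.log (ρ Ts (Φ (U₁, z))) - Real.log (ρ' Ts (Φ (U₁, z)))) * (wgt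 F γ b₀ p₀ j Ts ρ ρ' τ Φ J t) U₂ z ∂τ))| ≤ kX B B' * (‖m‖ / (θBal F.L γ b₀ p₀ j / 4)) * (‖m'‖ / (θBal F.L γ b₀ p₀ j / 4))) := by
  obtain ⟨kX, h0, hrow, hcol, hsq⟩ := hIlawX
  refine ⟨kX, h0, hrow, hcol, ?_⟩
  intro B B' m m' U₁ V₁ U₂ W₂ hm hm' hU₁ hV₁ hU₂ hW₂ hVU hVB hWU hWB
  obtain ⟨X, hoff, hon⟩ := exists_relPath U₂ B' m'
  obtain ⟨wN', b, bΔ, hbi, hbΔi, hmN, hlip, hlipΔ, hd, hcov⟩ := hsq B B' m m' U₁ V₁ U₂ W₂ hm hm' hU₁ hV₁ hU₂ hW₂ hVU hVB hWU hWB X hoff hon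
  have hp := hpath B' m' U₁ V₁ U₂ X hm' hU₁ hV₁ hU₂ hoff hon
  exact lawEdgeClause_of_covKernel_of_lip F γ b₀ p₀ j Ts ρ ρ' τ Φ J t U₁ V₁ U₂ W₂ X (relPath_zero hoff hon) (relPath_one hoff hon hWU hWB) wN'
    isOpen_Ioo (Icc_subset_Ioo (by norm_num) (by norm_num)) (fun s z => hw0 _ z) ((hmF V₁).sub (hmF U₁)) (fun s => hmW _) hmN
    (fun s hs => (hp s hs).1) (fun s hs => (hp s hs).2.1) (fun s hs => (hp s hs).2.2.1) hlip hbi hlipΔ hbΔi hd (fun s hs => (hp s hs).2.2.2) hcov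

/-- ★★★ **(L2ʲ-h) AT `t` FROM THE (I-law-L) BLOCK**: letter `kL` with ✓p812742's row mass, then per square and per RELATIONAL exponential square `(Y, X)`: an `s`-partial family `w₁`,
Lipschitz constants `b bF` valid at every `s′ ∈ [0,1]`, (Lip)∕(Diff₀) in `s`, and the SCORE kernel = `s′`-edge difference of the `s`-score covariance `≤ kL B B′·sz·sz′`; knit-side
`hw0 hmF hmW` + `hsqpath` (integrability ∕ mass on the square); conclusion = the (L2ʲ-h) conjunct at `t` VERBATIM. [folklore] -/
theorem l2j_of_ilaw (F : T3Family) (γ b₀ p₀ : ℝ) (j Ts : ℕ)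
    (ρ ρ' : (i : ℕ) → GaugeField (F.P i) 0 ↥(Matrix.specialUnitaryGroup (Fin 2) ℂ) → ℝ) {Zc : Type} [MeasurableSpace Zc] (τ : Measure Zc)
    (Φ : GaugeField (F.P j) 0 ↥(Matrix.specialUnitaryGroup (Fin 2) ℂ) × Zc → GaugeField (F.P Ts) 0 ↥(Matrix.specialUnitaryGroup (Fin 2) ℂ)) (J : GaugeField (F.P j) 0 ↥(Matrix.specialUnitaryGroup (Fin 2) ℂ) × Zc → NNReal)
    (κ rc w NL : ℝ) (δL : ℕ → ℝ) (t : ℝ)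
    (hw0 : ∀ (V : GaugeField (F.P j) 0 ↥(Matrix.specialUnitaryGroup (Fin 2) ℂ)) z, 0 ≤ wNum F γ b₀ p₀ j Ts ρ ρ' Φ J t V z)
    (hmF : ∀ (V : GaugeField (F.P j) 0 ↥(Matrix.specialUnitaryGroup (Fin 2) ℂ)), AEStronglyMeasurable (fun z => Real.log (ρ Ts (Φ (V, z))) - Real.log (ρ' Ts (Φ (V, z)))) τ)
    (hmW : ∀ (V : GaugeField (F.P j) 0 ↥(Matrix.specialUnitaryGroup (Fin 2) ℂ)), AEStronglyMeasurable (fun z => wNum F γ b₀ p₀ j Ts ρ ρ' Φ J t V z) τ)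
    (hsqpath : ∀ (B B' : PBond (F.P j) 0) (m m' : Fin 3 → ℝ) (V00 : GaugeField (F.P j) 0 ↥(Matrix.specialUnitaryGroup (Fin 2) ℂ)) (Y : ℝ → GaugeField (F.P j) 0 ↥(Matrix.specialUnitaryGroup (Fin 2) ℂ)) (X : ℝ → ℝ → GaugeField (F.P j) 0 ↥(Matrix.specialUnitaryGroup (Fin 2) ℂ)), ‖m‖ ≤ rc * (θBal F.L γ b₀ p₀ j / 4) → ‖m'‖ ≤ rc * (θBal F.L γ b₀ p₀ j / 4) →
      PlaqSmall (θBal F.L γ b₀ p₀ j / 4) V00 → (∀ s e, e ≠ B → Y s e = V00 e) → (∀ s, Y s B = V00 B * expPt (s • m)) → (∀ s s' e, e ≠ B' → X s s' e = Y s e) → (∀ s s', X s s' B' = Y s B' * expPt (s' • m')) →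
      ∀ s ∈ Set.Icc (0:ℝ) 1, ∀ s' ∈ Set.Icc (0:ℝ) 1, Integrable (fun z => wNum F γ b₀ p₀ j Ts ρ ρ' Φ J t (X s s') z) τ ∧ Integrable (fun z => (Real.log (ρ Ts (Φ (V00, z))) - Real.log (ρ' Ts (Φ (V00, z)))) * wNum F γ b₀ p₀ j Ts ρ ρ' Φ J t (X s s') z) τ ∧ ∫ z, wNum F γ b₀ p₀ j Ts ρ ρ' Φ J t (X s s') z ∂τ ≠ 0)
    (hIlawL : ∃ kL : PBond (F.P j) 0 → PBond (F.P j) 0 → ℝ, (∀ B B', 0 ≤ kL B B') ∧ (∀ B, ∑ B', kL B B' * Real.exp (κ * (B.src.tdist B'.src : ℝ)) ≤ NL * ((((F.L : ℝ) ^ j / γ) * θBal F.L γ b₀ p₀ j ^ 2) / (((F.L : ℝ) ^ Ts / γ) * θBal F.L γ b₀ p₀ Ts ^ 2)) * w + δL j * (((F.L : ℝ) ^ j / γ) * θBal F.L γ b₀ p₀ j ^ 2)) ∧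
      (∀ (B B' : PBond (F.P j) 0) (m m' : Fin 3 → ℝ) (V00 V10 V01 V11 : GaugeField (F.P j) 0 ↥(Matrix.specialUnitaryGroup (Fin 2) ℂ)), ‖m‖ ≤ rc * (θBal F.L γ b₀ p₀ j / 4) → ‖m'‖ ≤ rc * (θBal F.L γ b₀ p₀ j / 4) → PlaqSmall (θBal F.L γ b₀ p₀ j / 4) V00 → PlaqSmall (θBal F.L γ b₀ p₀ j / 4) V10 → PlaqSmall (θBal F.L γ b₀ p₀ j / 4) V01 → PlaqSmall (θBal F.L γ b₀ p₀ j / 4) V11 → (∀ e, e ≠ B → V10 e = V00 e) → V10 B = V00 B * expPt m → (∀ e, e ≠ B' → V01 e = V00 e) → V01 B' = V00 B' * expPt m' → (∀ e, e ≠ B' → V11 e = V10 e) → V11 B' = V10 B' * expPt m' → ∀ (Y : ℝ → GaugeField (F.P j) 0 ↥(Matrix.specialUnitaryGroup (Fin 2) ℂ)) (X : ℝ → ℝ → GaugeField (F.P j) 0 ↥(Matrix.specialUnitaryGroup (Fin 2) ℂ)), (∀ s e, e ≠ B → Y s e = V00 e) → (∀ s, Y s B = V00 B * expPt (s • m)) →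 (∀ s s' e, e ≠ B' → X s s' e = Y s e) → (∀ s s', X s s' B' = Y s B' * expPt (s' • m')) →
          ∃ (w₁ : ℝ → ℝ → Zc → ℝ) (b bF : Zc → ℝ), Integrable b τ ∧ Integrable bF τ ∧ (∀ s s', AEStronglyMeasurable (w₁ s s') τ) ∧
            (∀ s' ∈ Set.Icc (0:ℝ) 1, ∀ᵐ z ∂τ, LipschitzOnWith (Real.nnabs (b z)) (fun s => wNum F γ b₀ p₀ j Ts ρ ρ' Φ J t (X s s') z) (Set.Ioo (-1) 2)) ∧
            (∀ s' ∈ Set.Icc (0:ℝ) 1, ∀ᵐ z ∂τ, LipschitzOnWith (Real.nnabs (bF z)) (fun s => (Real.log (ρ Ts (Φ (V00, z))) - Real.log (ρ' Ts (Φ (V00, z)))) * wNum F γ b₀ p₀ j Ts ρ ρ' Φ J t (X s s') z) (Set.Ioo (-1) 2)) ∧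
            (∀ s ∈ Set.Icc (0:ℝ) 1, ∀ s' ∈ Set.Icc (0:ℝ) 1, ∀ᵐ z ∂τ, HasDerivAt (fun s => wNum F γ b₀ p₀ j Ts ρ ρ' Φ J t (X s s') z) (w₁ s s' z) s) ∧
            (∀ s ∈ Set.Icc (0:ℝ) 1, |((∫ z, (Real.log (ρ Ts (Φ (V00, z))) - Real.log (ρ' Ts (Φ (V00, z)))) * (w₁ s 1 z / wNum F γ b₀ p₀ j Ts ρ ρ' Φ J t (X s 1) z) * (wNum F γ b₀ p₀ j Ts ρ ρ' Φ J t (X s 1) z / ∫ z', wNum F γ b₀ p₀ j Ts ρ ρ' Φ J t (X s 1) z' ∂τ) ∂τ)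
                  - (∫ z, (Real.log (ρ Ts (Φ (V00, z))) - Real.log (ρ' Ts (Φ (V00, z)))) * (wNum F γ b₀ p₀ j Ts ρ ρ' Φ J t (X s 1) z / ∫ z', wNum F γ b₀ p₀ j Ts ρ ρ' Φ J t (X s 1) z' ∂τ) ∂τ) * (∫ z, (w₁ s 1 z / wNum F γ b₀ p₀ j Ts ρ ρ' Φ J t (X s 1) z) * (wNum F γ b₀ p₀ j Ts ρ ρ' Φ J t (X s 1) z / ∫ z', wNum F γ b₀ p₀ j Ts ρ ρ' Φ J t (X s 1) z' ∂τ) ∂τ))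
                - ((∫ z, (Real.log (ρ Ts (Φ (V00, z))) - Real.log (ρ' Ts (Φ (V00, z)))) * (w₁ s 0 z / wNum F γ b₀ p₀ j Ts ρ ρ' Φ J t (X s 0) z) * (wNum F γ b₀ p₀ j Ts ρ ρ' Φ J t (X s 0) z / ∫ z', wNum F γ b₀ p₀ j Ts ρ ρ' Φ J t (X s 0) z' ∂τ) ∂τ)
                  - (∫ z, (Real.log (ρ Ts (Φ (V00, z))) - Real.log (ρ' Ts (Φ (V00, z)))) * (wNum F γ b₀ p₀ j Ts ρ ρ' Φ J t (X s 0) z / ∫ z', wNum F γ b₀ p₀ j Ts ρ ρ' Φ J t (X s 0) z' ∂τ) ∂τ) * (∫ z, (w₁ s 0 z / wNum F γ b₀ p₀ j Ts ρ ρ' Φ J t (X s 0) z) * (wNum F γ b₀ p₀ j Ts ρ ρ' Φ J t (X s 0) z / ∫ z', wNum F γ b₀ p₀ j Ts ρ ρ' Φ J t (X s 0) z' ∂τ) ∂τ))| ≤ kL B B' * (‖m‖ / (θBal F.L γ b₀ p₀ j / 4)) * (‖m'‖ / (θBal F.L γ b₀ p₀ j / 4))))) :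
    ∃ kL : PBond (F.P j) 0 → PBond (F.P j) 0 → ℝ, (∀ B B', 0 ≤ kL B B') ∧ (∀ B, ∑ B', kL B B' * Real.exp (κ * (B.src.tdist B'.src : ℝ)) ≤ NL * ((((F.L : ℝ) ^ j / γ) * θBal F.L γ b₀ p₀ j ^ 2) / (((F.L : ℝ) ^ Ts / γ) * θBal F.L γ b₀ p₀ Ts ^ 2)) * w + δL j * (((F.L : ℝ) ^ j / γ) * θBal F.L γ b₀ p₀ j ^ 2)) ∧
      (∀ (B B' : PBond (F.P j) 0) (m m' : Fin 3 → ℝ) (V00 V10 V01 V11 : GaugeField (F.P j) 0 ↥(Matrix.specialUnitaryGroup (Fin 2) ℂ)), ‖m‖ ≤ rc * (θBal F.L γ b₀ p₀ j / 4) → ‖m'‖ ≤ rc * (θBal F.L γ b₀ p₀ j / 4) → PlaqSmall (θBal F.L γ b₀ p₀ j / 4) V00 → PlaqSmall (θBal F.L γ b₀ p₀ j / 4) V10 → PlaqSmall (θBal F.L γ b₀ p₀ j / 4) V01 → PlaqSmall (θBal F.L γ b₀ p₀ j / 4) V11 → (∀ e, e ≠ B → V10 e = V00 e) → V10 B = V00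 B * expPt m → (∀ e, e ≠ B' → V01 e = V00 e) → V01 B' = V00 B' * expPt m' → (∀ e, e ≠ B' → V11 e = V10 e) → V11 B' = V10 B' * expPt m' → Integrable (fun z => (Real.log (ρ Ts (Φ (V00, z))) - Real.log (ρ' Ts (Φ (V00, z)))) * (wgt F γ b₀ p₀ j Ts ρ ρ' τ Φ J t) V00 z) τ ∧ Integrable (fun z => (Real.log (ρ Ts (Φ (V00, z))) - Real.log (ρ' Ts (Φ (V00, z)))) * (wgt F γ b₀ p₀ j Ts ρ ρ' τ Φ J t) V10 z) τ ∧ Integrable (fun z => (Real.log (ρ Ts (Φ (V00, z))) - Real.log (ρ' Ts (Φ (V00, z)))) * (wgt F γ b₀ p₀ j Ts ρ ρ' τ Φ J t) V01 z) τ ∧ Integrable (fun z => (Real.log (ρ Ts (Φ (V00, z))) - Real.log (ρ' Ts (Φ (V00, z)))) * (wgt F γ b₀ p₀ j Ts ρ ρ' τ Φ J t) V11 z) τ ∧ |(∫ z, (Real.log (ρ Ts (Φ (V00, z))) - Real.log (ρ' Ts (Φ (V00, z)))) * (wgt F γ b₀ p₀ j Ts ρ ρ' τ Φ J t) V11 z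 ∂τ) - (∫ z, (Real.log (ρ Ts (Φ (V00, z))) - Real.log (ρ' Ts (Φ (V00, z)))) * (wgt F γ b₀ p₀ j Ts ρ ρ' τ Φ J t) V10 z ∂τ) - (∫ z, (Real.log (ρ Ts (Φ (V00, z))) - Real.log (ρ' Ts (Φ (V00, z)))) * (wgt F γ b₀ p₀ j Ts ρ ρ' τ Φ J t) V01 z ∂τ) + (∫ z, (Real.log (ρ Ts (Φ (V00, z))) - Real.log (ρ' Ts (Φ (V00, z)))) * (wgt F γ b₀ p₀ j Ts ρ ρ' τ Φ J t) V00 z ∂τ)| ≤ kL B B' * (‖m‖ / (θBal F.L γ b₀ p₀ j / 4)) * (‖m'‖ / (θBal F.L γ b₀ p₀ j / 4))) := by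
  obtain ⟨kL, h0, hrow, hsq⟩ := hIlawL
  refine ⟨kL, h0, hrow, ?_⟩
  intro B B' m m' V00 V10 V01 V11 hm hm' h00 h10 h01 h11 h10off h10on h01off h01on h11off h11on
  obtain ⟨Y, X, hYoff, hYon, hXoff, hXon⟩ := exists_relSquare V00 B B' m m'
  obtain ⟨w₁, b, bF, hbi, hbFi, hm₁, hlip, hlipF, hd₁, hker⟩ :=
    hsq B B' m m' V00 V10 V01 V11 hm hm' h00 h10 h01 h11 h10off h10on h01off h01on h11off h11on Y X hYoff hYon hXoff hXon
  have hc := relSquare_corners hYoff hYon hXoff hXon h10off h10on h01off h01on h11off h11on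
  have hp := hsqpath B B' m m' V00 Y X hm hm' h00 hYoff hYon hXoff hXon
  exact lawSquareClause_of_edgeKernel_of_lip F γ b₀ p₀ j Ts ρ ρ' τ Φ J t V00 V10 V01 V11 X hc.1 hc.2.1 hc.2.2.1 hc.2.2.2 w₁
    isOpen_Ioo (Icc_subset_Ioo (by norm_num) (by norm_num)) (fun s s' z => hw0 _ z) (hmF V00) (fun s s' => hmW _) hm₁
    (fun s hs s' hs' => (hp s hs s' hs').1) (fun s hs s' hs' => (hp s hs s' hs').2.1) hlip hbi hlipF hbFi hd₁
    (fun s hs s' hs' => (hp s hs s' hs').2.2) hker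

end Clauses

end Summit.QuantumFields.YangMills.Theorems.OrganTangentLawClausesOfILaw

end
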